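import Mathlib
import Summits.Ventures.PercRepro2.Defs
import Summits.Ventures.PercRepro2.Harris
import Summits.Ventures.PercRepro2.Graph
import Summits.Ventures.PercRepro2.Induced
import Summits.Ventures.PercRepro2.VdBKahn
import Summits.Ventures.PercRepro2.NestIID
import Summits.Ventures.PercRepro2.ZMeanBound
import Summits.Ventures.PercRepro2.SideDefs
import Summits.Ventures.PercRepro2.SideLogSupermod
import Summits.Ventures.PercRepro2.SideCluster

/-!
# Log-supermodular status laws: the two-vertex base case and coarsening
(blind cell PercRepro2, mine-1 g13; proofs/MINE1-LSM-CHARACTERISATION.md)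

Two formal pieces of the characterisation «the status law `W S = P(C ∩ F = S, C ∩ T = ∅)` is
log-supermodular for all weights iff every 2-connected block sees at most two observed vertices
besides its entry»:

* `statusLogSupermod_of_card_le_two` — for `|F| ≤ 2` the FKG lattice condition on `2^F` reduces to
  the single van den Berg–Kahn atom `W_x W_y ≤ W_{xy} W_∅` (`sidePair_two`); this is the base case
  of the block-tree factorisation (each block with ≤ 2 observed vertices contributes a
  log-supermodular local law).
* `statusLogSupermod_mono` — COARSENING: if the status law on `2^F` is log-supermodular, so is the
  status law on `2^F₀` for every `F₀ ⊆ F`. The status on `F₀` is the image of the status on `F`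
  under the lattice homomorphism `S ↦ S ∩ F₀`, and the four functions theorem (Ahlswede–Daykin,
  Mathlib `four_functions_theorem_univ`) transports the lattice condition along it (the partition
  identity `statusMass_eq_sum_statusMass_of_subset` is proved through the cluster law, as in
  `SideCluster.statusMass_eq_sum_clusterMass`). Coarsening is the step that lets a violation on a
  block's three observed vertices refute log-supermodularity for every larger test set
  (the necessity direction of the characterisation), and it yields (SIDE) on every sub-test-set of
  a log-supermodular one (`sideIneq_of_statusLogSupermod_of_subset`).
-/

namespace Summit.Ventures.PercRepro2

section StatusLSM

variable {V : Type*} {E : Type*} [Fintype E] [DecidableEq E] [Fintype V] [DecidableEq V]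
  {R : Type*} [CommRing R] [LinearOrder R] [IsStrictOrderedRing R]

variable {p : E → R} (ends : E → Sym2 V) (s : V)

omit [Fintype V] [IsStrictOrderedRing R] in
/-- Nested statuses satisfy the lattice condition with equality. -/
lemma statusMass_mul_le_of_subset (T F S S' : Finset V) (hSS' : S ⊆ S') :
    statusMass p ends s T F S * statusMass p ends s T F S' ≤
      statusMass p ends s T F (S ∩ S') * statusMass p ends s T F (S ∪ S') := by
  rw [Finset.inter_eq_left.mpr hSS', Finset.union_eq_right.mpr hSS']

/-- **Two test vertices**: the status law on `2^F` with `|F| ≤ 2` is log-supermodular for every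
weight vector and every avoided set `T` disjoint from `F` — the only non-nested pair is
`({x}, {y})`, whose lattice condition is the van den Berg–Kahn atom `sidePair_two`. -/
theorem statusLogSupermod_of_card_le_two (hp : IsProbVec p) (T F : Finset V)
    (hTF : Disjoint T F) (hF : F.card ≤ 2) : StatusLogSupermod p ends s T F := by
  intro S S' hS hS'
  by_cases hSS' : S ⊆ S'
  · exact statusMass_mul_le_of_subset ends s T F S S' hSS'
  by_cases hS'S : S' ⊆ S
  · rw [mul_comm, Finset.inter_comm, Finset.union_comm]
    exact statusMass_mul_le_of_subset ends s T F S' S hS'S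
  obtain ⟨x, hxS, hxS'⟩ := Finset.not_subset.mp hSS'
  obtain ⟨y, hyS', hyS⟩ := Finset.not_subset.mp hS'S
  have hxy : x ≠ y := fun h => hxS' (h ▸ hyS')
  have hxF : x ∈ F := hS hxS
  have hyF : y ∈ F := hS' hyS'
  have hFxy : F = {x, y} := by
    symm
    apply Finset.eq_of_subset_of_card_le
    · intro z hz
      rw [Finset.mem_insert, Finset.mem_singleton] at hz
      rcases hz with rfl | rfl
      · exact hxF
      · exact hyF
    · rw [Finset.card_pair hxy]; exact hF
  have hSx : S = {x} := by
    apply Finset.eq_singleton_iff_unique_mem.mpr ⟨hxS, ?_⟩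
    intro z hz
    have hzF := hS hz
    rw [hFxy, Finset.mem_insert, Finset.mem_singleton] at hzF
    rcases hzF with rfl | rfl
    · rfl
    · exact absurd hz hyS
  have hS'y : S' = {y} := by
    apply Finset.eq_singleton_iff_unique_mem.mpr ⟨hyS', ?_⟩
    intro z hz
    have hzF := hS' hz
    rw [hFxy, Finset.mem_insert, Finset.mem_singleton] at hzF
    rcases hzF with rfl | rfl
    · exact absurd hz hxS'
    · rfl
  have hxT : x ∉ T := fun h => Finset.disjoint_left.mp hTF h hxF
  have hyT : y ∉ T := fun h => Finset.disjoint_left.mp hTF h hyF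
  have h := sidePair_two p ends s hp x y hxy T hxT hyT
  have e1 : ({x, y} : Finset V) \ {x} = {y} := by
    ext v
    simp only [Finset.mem_sdiff, Finset.mem_insert, Finset.mem_singleton]
    constructor
    · rintro ⟨h1, h2⟩
      rcases h1 with rfl | rfl
      · exact absurd rfl h2
      · rfl
    · rintro rfl
      exact ⟨Or.inr rfl, fun h => hxy h.symm⟩
  have e2 : ({x} : Finset V) ∩ {y} = ∅ :=
    Finset.disjoint_iff_inter_eq_empty.mp (Finset.disjoint_singleton.mpr hxy)
  simp only [compMass, e1, Finset.sdiff_self] at h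
  rw [hSx, hS'y, hFxy, e2, ← Finset.insert_eq]
  exact h.trans_eq (mul_comm _ _)

omit [LinearOrder R] [IsStrictOrderedRing R] in
/-- **Partition of a status mass by a finer status**: for `F₀ ⊆ F` and `S₀ ⊆ F₀`,
`P(C ∩ F₀ = S₀, C ∩ T = ∅) = ∑_{S ⊆ F, S ∩ F₀ = S₀} P(C ∩ F = S, C ∩ T = ∅)`
(both sides expanded through the cluster law). -/
lemma statusMass_eq_sum_statusMass_of_subset (T F F₀ S₀ : Finset V) (hF₀ : F₀ ⊆ F)
    (hS₀ : S₀ ⊆ F₀) :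
    statusMass p ends s T F₀ S₀ =
      ∑ S : Finset V, if S ⊆ F ∧ S ∩ F₀ = S₀ then statusMass p ends s T F S else 0 := by
  classical
  have hterm : ∀ S : Finset V,
      (if S ⊆ F ∧ S ∩ F₀ = S₀ then statusMass p ends s T F S else 0) =
        ∑ c : Finset V, clusterMass p ends s c *
          (if S ⊆ F ∧ S ∩ F₀ = S₀ ∧ S ⊆ c ∧ ∀ x ∈ T ∪ (F \ S), x ∉ c then 1 else 0) := by
    intro S
    split_ifs with h
    · rw [statusMass_eq_sum_clusterMass]
      refine Finset.sum_congr rfl fun c _ => ?_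
      congr 1
      simp only [h.1, h.2, true_and]
    · symm
      refine Finset.sum_eq_zero fun c _ => ?_
      rw [if_neg, mul_zero]
      intro h'
      exact h ⟨h'.1, h'.2.1⟩
  simp_rw [hterm]
  rw [Finset.sum_comm, statusMass_eq_sum_clusterMass]
  refine Finset.sum_congr rfl fun c _ => ?_
  rw [← Finset.mul_sum]
  congr 1
  rw [Finset.sum_eq_single (c ∩ F)]
  · -- the only possible status on `F` of a cluster `c` is `c ∩ F`
    have h1 : c ∩ F ⊆ F := Finset.inter_subset_right
    have h2 : c ∩ F ⊆ c := Finset.inter_subset_left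
    have h3 : c ∩ F ∩ F₀ = c ∩ F₀ := by
      rw [Finset.inter_assoc, Finset.inter_eq_right.mpr hF₀]
    by_cases hc : S₀ ⊆ c ∧ ∀ x ∈ T ∪ (F₀ \ S₀), x ∉ c
    · rw [if_pos hc, if_pos]
      refine ⟨h1, ?_, h2, ?_⟩
      · rw [h3]
        ext v
        simp only [Finset.mem_inter]
        constructor
        · rintro ⟨hvc, hvF₀⟩
          by_contra hvS₀
          exact hc.2 v (Finset.mem_union_right _ (Finset.mem_sdiff.mpr ⟨hvF₀, hvS₀⟩)) hvc
        · intro hv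
          exact ⟨hc.1 hv, hS₀ hv⟩
      · intro v hv hvc
        rcases Finset.mem_union.mp hv with hvT | hvF
        · exact hc.2 v (Finset.mem_union_left _ hvT) hvc
        · rw [Finset.mem_sdiff, Finset.mem_inter] at hvF
          exact hvF.2 ⟨hvc, hvF.1⟩
    · rw [if_neg hc, if_neg]
      intro h'
      apply hc
      rw [h3] at h'
      refine ⟨?_, ?_⟩
      · intro v hv
        have : v ∈ c ∩ F₀ := h'.2.1 ▸ hv
        exact (Finset.mem_inter.mp this).1
      · intro v hv hvc
        rcases Finset.mem_union.mp hv with hvT | hvF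
        · exact h'.2.2.2 v (Finset.mem_union_left _ hvT) hvc
        · rw [Finset.mem_sdiff] at hvF
          apply hvF.2
          rw [← h'.2.1]
          exact Finset.mem_inter.mpr ⟨hvc, hvF.1⟩
  · intro S _ hS
    rw [if_neg]
    intro h'
    apply hS
    ext v
    simp only [Finset.mem_inter]
    constructor
    · intro hv
      exact ⟨h'.2.2.1 hv, h'.1 hv⟩
    · rintro ⟨hvc, hvF⟩
      by_contra hvS
      exact h'.2.2.2 v (Finset.mem_union_right _ (Finset.mem_sdiff.mpr ⟨hvF, hvS⟩)) hvc
  · intro h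
    exact absurd (Finset.mem_univ _) h

/-- **Coarsening (four functions)**: a log-supermodular status law on `2^F` induces a
log-supermodular status law on `2^F₀` for every `F₀ ⊆ F` — the status on `F₀` is the image of the
status on `F` under the lattice homomorphism `S ↦ S ∩ F₀`. -/
theorem statusLogSupermod_mono (hp : IsProbVec p) (T F F₀ : Finset V) (hF₀ : F₀ ⊆ F)
    (hW : StatusLogSupermod p ends s T F) : StatusLogSupermod p ends s T F₀ := by
  intro S₀ S₀' hS₀ hS₀'
  classical
  let χ : Finset V → Finset V → R := fun S₀ S => if S ⊆ F ∧ S ∩ F₀ = S₀ then 1 else 0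
  have hm0 : ∀ S, 0 ≤ statusMass p ends s T F S := fun S => statusMass_nonneg ends s T F hp S
  have hχ0 : ∀ S₀ S, 0 ≤ χ S₀ S := fun S₀ S => by simp only [χ]; split_ifs <;> norm_num
  have key : ∀ S₀, S₀ ⊆ F₀ →
      statusMass p ends s T F₀ S₀ = ∑ S : Finset V, statusMass p ends s T F S * χ S₀ S := by
    intro S₀ hS₀
    rw [statusMass_eq_sum_statusMass_of_subset ends s T F F₀ S₀ hF₀ hS₀]
    refine Finset.sum_congr rfl fun S _ => ?_
    simp only [χ]
    split_ifs <;> simp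
  rw [key S₀ hS₀, key S₀' hS₀', key (S₀ ∩ S₀') (Finset.inter_subset_left.trans hS₀),
    key (S₀ ∪ S₀') (Finset.union_subset hS₀ hS₀')]
  refine four_functions_theorem_univ (fun S => statusMass p ends s T F S * χ S₀ S)
    (fun S => statusMass p ends s T F S * χ S₀' S)
    (fun S => statusMass p ends s T F S * χ (S₀ ∩ S₀') S)
    (fun S => statusMass p ends s T F S * χ (S₀ ∪ S₀') S)
    (fun S => mul_nonneg (hm0 S) (hχ0 _ S)) (fun S => mul_nonneg (hm0 S) (hχ0 _ S))
    (fun S => mul_nonneg (hm0 S) (hχ0 _ S)) (fun S => mul_nonneg (hm0 S) (hχ0 _ S)) ?_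
  intro a b
  simp only [χ]
  by_cases ha : a ⊆ F ∧ a ∩ F₀ = S₀
  · by_cases hb : b ⊆ F ∧ b ∩ F₀ = S₀'
    · have hab : a ⊓ b ⊆ F ∧ (a ⊓ b) ∩ F₀ = S₀ ∩ S₀' := by
        refine ⟨inf_le_left.trans ha.1, ?_⟩
        rw [Finset.inf_eq_inter, ← ha.2, ← hb.2]
        ext v
        simp only [Finset.mem_inter]
        tauto
      have hab' : a ⊔ b ⊆ F ∧ (a ⊔ b) ∩ F₀ = S₀ ∪ S₀' := by
        refine ⟨sup_le ha.1 hb.1, ?_⟩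
        rw [Finset.sup_eq_union, ← ha.2, ← hb.2]
        ext v
        simp only [Finset.mem_inter, Finset.mem_union]
        tauto
      rw [if_pos ha, if_pos hb, if_pos hab, if_pos hab']
      simpa using hW a b ha.1 hb.1
    · rw [if_neg hb, mul_zero, mul_zero]
      exact mul_nonneg (mul_nonneg (hm0 _) (hχ0 _ _)) (mul_nonneg (hm0 _) (hχ0 _ _))
  · rw [if_neg ha, mul_zero, zero_mul]
    exact mul_nonneg (mul_nonneg (hm0 _) (hχ0 _ _)) (mul_nonneg (hm0 _) (hχ0 _ _))

/-- **(SIDE) on every sub-test-set of a log-supermodular test set.** -/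
theorem sideIneq_of_statusLogSupermod_of_subset (hp : IsProbVec p) (T F F₀ : Finset V)
    (hF₀ : F₀ ⊆ F) (hW : StatusLogSupermod p ends s T F) : SideIneq p ends s T F₀ :=
  sideIneq_of_statusLogSupermod ends s T F₀ hp (statusLogSupermod_mono ends s hp T F F₀ hF₀ hW)

end StatusLSM

end Summit.Ventures.PercRepro2
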